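import Summits.HubbardSuperconductivity.HubbardSuperconductivity.Theorems.AposterioriCapRgSsbToEvenTorusLroPairTransferRung
import HarnessLib

/-!
# Route `JosephsonMirror` — crux `JmInterchange` (stmt-HubbardSuperconductivity-2227), line `Sketch`,
# stub `stub_symmetricWindowInputs`: what the tree gives (ASSESSMENT; the stub itself is NOT proved here)

The stub `SymmetricWindowInputs` asks, at every `(U, δ)` with floor order, for ONE scale `γ_L` with
`γ_L L² → ∞` carrying both bridge inputs of the engine `bridgeFromFloorOrder`:
low-lying orthogonality (LLO) in the sector `(N_L - 2, S^z = 0)` and the charging floor (CF)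
`2e(N_L) - e(N_L + 2) - e(N_L - 2) ≤ εγ_L`, `N_L = 2⌊(1-δ)L²/2⌋₊`, `e(k) = minEnergyOn H (szSector k 0)`,
`H = hubbardTorus 2 L 1 U`.  Two checked facts:

* `chargingFloor_of_tendsto_atTop` — CF is FREE at every divergent scale `γ_L → +∞` (no hypothesis on
  `U`): by the bulk-window two-particle cost `Theorems.ptr_twoParticleCost` at `a = δ/2`, used at
  `n = k` and `n = k - 1` (`N_L = 2k`; side conditions `δL²/2 ≤ 2k - 1`, `2k + 2 ≤ (2 - δ/2)L²`, valid for
  `L ≥ 4`), `2e(2k) - e(2k+2) - e(2k-2) ≤ |e(2k) - e(2k+2)| + |e(2k-2) - e(2k)| ≤ 2C₃ ≤ εγ_L` eventually.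
* `symmetricWindowInputs_of_divergentLLO` — hence the stub follows from LLO ALONE at SOME divergent
  scale `γ_L → +∞` (then `γ_L L² → ∞` trivially); the floor-order hypothesis is not used.

What is NOT in the tree (the residual model fact): LLO at any admissible scale, i.e. a
symmetry-resolved lower bound on the spectrum of `H` in the sector `(N_L - 2, 0)` seen by `Δ_d G(N_L)`.

Sources: D. Ruelle, *Statistical Mechanics* (1969) §3.4 (one-particle cost); E. H. Lieb, PRL 62 (1989)
1201 (`S^z = 0` carries the ground energy); T. Koma, H. Tasaki, J. Stat. Phys. 76 (1994) 745.
No new definitions.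
-/

-- the mandated namespace `Summit.<Summit>.<Problem>.Theorems` repeats `HubbardSuperconductivity`
-- (single-problem summit, D-0017), which the `dupNamespace` linter flags on every declaration
set_option linter.dupNamespace false

namespace Summit.HubbardSuperconductivity.HubbardSuperconductivity.Theorems.JosephsonMirror

open Matrix Literature.MathematicalPhysics.QuantumLattice Filter

/-- **The charging floor is free at a divergent scale.** For `δ ∈ (0, 1/2)` and any `γ_L → +∞`:
for every `ε > 0`, eventually in `L`, `2e(N_L) - e(N_L + 2) - e(N_L - 2) ≤ εγ_L`, where
`e(k) = minEnergyOn (hubbardTorus 2 L 1 U) (szSector k 0)` and `N_L = 2⌊(1-δ)L²/2⌋₊`; indeed the left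
side is `≤ 2C₃(U, δ/2)` for `L ≥ 4` by the two-particle cost `ptr_twoParticleCost` (Ruelle 1969 §3.4,
Lieb 1989) at `n = N_L/2` and `n = N_L/2 - 1`. [folklore] -/
theorem chargingFloor_of_tendsto_atTop (U δ : ℝ) (hδ : δ ∈ Set.Ioo (0:ℝ) (1 / 2)) (γ : ℕ → ℝ)
    (hγ : Tendsto γ atTop atTop) :
    ∀ ε : ℝ, 0 < ε → ∃ L₀ : ℕ, ∀ (L : ℕ), Even L → L₀ ≤ L →
      (let e : ℕ → ℝ := fun n => (hubbardTorus 2 L 1 U).minEnergyOn (szSector n 0)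
       let N : ℕ := 2 * ⌊(1 - δ) * (L : ℝ) ^ 2 / 2⌋₊
       2 * e N - e (N + 2) - e (N - 2) ≤ ε * γ L) := by
  obtain ⟨C₃, hC₃, hC⟩ :=
    Summit.HubbardSuperconductivity.HubbardSuperconductivity.Theorems.ptr_twoParticleCost U (δ / 2)
      (by linarith [hδ.1])
  intro ε hε
  obtain ⟨L₁, hL₁⟩ := tendsto_atTop_atTop.1 hγ (2 * C₃ / ε)
  refine ⟨max L₁ 4, fun L _ hL => ?_⟩
  obtain ⟨hL₁', h4⟩ := max_le_iff.1 hL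
  dsimp only
  haveI : NeZero L := ⟨by omega⟩
  -- the filling `N_L = 2n`, `n = ⌊(1-δ)L²/2⌋`, and the two bulk windows of the two-particle cost
  set n : ℕ := ⌊(1 - δ) * (L : ℝ) ^ 2 / 2⌋₊ with hn
  have hL4 : (4 : ℝ) ≤ L := by exact_mod_cast h4
  have hL16 : (16 : ℝ) ≤ (L : ℝ) ^ 2 := by nlinarith
  have hfl : (1 - δ) * (L : ℝ) ^ 2 / 2 < n + 1 := by rw [hn]; exact Nat.lt_floor_add_one _
  have hfu : (n : ℝ) ≤ (1 - δ) * (L : ℝ) ^ 2 / 2 := by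
    rw [hn]
    exact Nat.floor_le (div_nonneg (mul_nonneg (by linarith [hδ.2]) (sq_nonneg _)) (by norm_num))
  have hp1 : 1 / 4 * (L : ℝ) ^ 2 ≤ (1 - 3 * δ / 2) * (L : ℝ) ^ 2 :=
    mul_le_mul_of_nonneg_right (by linarith [hδ.2]) (sq_nonneg _)
  have hp2 : 0 ≤ δ / 2 * (L : ℝ) ^ 2 := mul_nonneg (by linarith [hδ.1]) (sq_nonneg _)
  have hn1 : 1 ≤ n := by
    have : (1 : ℝ) ≤ n := by linarith
    exact_mod_cast this
  -- window at `n`: `δL²/2 ≤ 2n + 1`, `2n + 2 ≤ (2 - δ/2)L²`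
  have hA1 : δ / 2 * (L : ℝ) ^ 2 ≤ 2 * (n : ℝ) + 1 := by linarith
  have hA2 : 2 * (n : ℝ) + 2 ≤ (2 - δ / 2) * (L : ℝ) ^ 2 := by linarith
  -- window at `n - 1`: `δL²/2 ≤ 2n - 1`, `2n ≤ (2 - δ/2)L²`
  have hcast : ((n - 1 : ℕ) : ℝ) = (n : ℝ) - 1 := by rw [Nat.cast_sub hn1, Nat.cast_one]
  have hB1 : δ / 2 * (L : ℝ) ^ 2 ≤ 2 * ((n - 1 : ℕ) : ℝ) + 1 := by rw [hcast]; linarith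
  have hB2 : 2 * ((n - 1 : ℕ) : ℝ) + 2 ≤ (2 - δ / 2) * (L : ℝ) ^ 2 := by rw [hcast]; linarith
  have h1 := hC L n hA1 hA2
  have h2 := hC L (n - 1) hB1 hB2
  rw [show 2 * (n - 1) + 2 = 2 * n by omega] at h2
  rw [show 2 * n - 2 = 2 * (n - 1) by omega]
  -- the scale: `2C₃ ≤ εγ_L`
  have hγL : 2 * C₃ ≤ ε * γ L := by
    have := (div_le_iff₀ hε).1 (hL₁ L hL₁')
    linarith
  linarith [(abs_le.1 h1).2, (abs_le.1 h2).1]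

/-- **Reduction of the stub to divergent-scale low-lying orthogonality.** If at every `(U, δ)` there is
a scale `γ_L → +∞` such that, eventually in even `L`, every eigenvector `w` of `H = hubbardTorus 2 L 1 U`
in the sector `(N_L - 2, S^z = 0)` with eigenvalue in the open window `(e(N_L-2), e(N_L-2) + γ_L)` is
orthogonal to `Δ_d g` for every sector-`(N_L, 0)` ground state `g`, then the stub
`SymmetricWindowInputs` of line `Sketch` holds (unfolded): `γ_L L² → ∞` is immediate and the charging
floor is `chargingFloor_of_tendsto_atTop`; the floor-order hypothesis is not used. [folklore] -/
theorem symmetricWindowInputs_of_divergentLLO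
    (hR : ∀ (U δ : ℝ), 0 < U → δ ∈ Set.Ioo (0:ℝ) (1 / 2) →
      ∃ γ : ℕ → ℝ, Tendsto γ atTop atTop ∧
        ∃ L₀ : ℕ, ∀ (L : ℕ) [NeZero L], Even L → L₀ ≤ L →
          ∀ g : Fock (Orb (FermionTorus 2 L)),
            IsGroundStateInSector (hubbardTorus 2 L 1 U) (2 * ⌊(1 - δ) * (L : ℝ) ^ 2 / 2⌋₊) 0 g →
            ∀ (w : Fock (Orb (FermionTorus 2 L))) (E : ℝ),
              w ∈ szSector (2 * ⌊(1 - δ) * (L : ℝ) ^ 2 / 2⌋₊ - 2) 0 →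
              hubbardTorus 2 L 1 U *ᵥ w = (E : ℂ) • w →
              (hubbardTorus 2 L 1 U).minEnergyOn (szSector (2 * ⌊(1 - δ) * (L : ℝ) ^ 2 / 2⌋₊ - 2) 0) < E →
              E < (hubbardTorus 2 L 1 U).minEnergyOn
                  (szSector (2 * ⌊(1 - δ) * (L : ℝ) ^ 2 / 2⌋₊ - 2) 0) + γ L →
                star w ⬝ᵥ (pairField dWaveFormFactor L *ᵥ g) = 0) :
    ∀ (U δ : ℝ), 0 < U → δ ∈ Set.Ioo (0:ℝ) (1 / 2) →
    (∃ c : ℝ, 0 < c ∧ ∃ L₀ : ℕ, ∀ (L : ℕ) [NeZero L], Even L → L₀ ≤ L →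
      ∃ g : Fock (Orb (FermionTorus 2 L)),
        IsGroundStateInSector (hubbardTorus 2 L 1 U) (2 * ⌊(1 - δ) * (L : ℝ) ^ 2 / 2⌋₊) 0 g ∧
        star g ⬝ᵥ g = 1 ∧
        c * (L : ℝ) ^ 4 ≤
          (star (pairField dWaveFormFactor L *ᵥ g) ⬝ᵥ (pairField dWaveFormFactor L *ᵥ g)).re) →
    ∃ γ : ℕ → ℝ, Tendsto (fun L : ℕ => γ L * (L : ℝ) ^ 2) atTop atTop ∧
      (∃ L₀ : ℕ, ∀ (L : ℕ) [NeZero L], Even L → L₀ ≤ L →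
        ∀ g : Fock (Orb (FermionTorus 2 L)),
          IsGroundStateInSector (hubbardTorus 2 L 1 U) (2 * ⌊(1 - δ) * (L : ℝ) ^ 2 / 2⌋₊) 0 g →
          ∀ (w : Fock (Orb (FermionTorus 2 L))) (E : ℝ),
            w ∈ szSector (2 * ⌊(1 - δ) * (L : ℝ) ^ 2 / 2⌋₊ - 2) 0 →
            hubbardTorus 2 L 1 U *ᵥ w = (E : ℂ) • w →
            (hubbardTorus 2 L 1 U).minEnergyOn (szSector (2 * ⌊(1 - δ) * (L : ℝ) ^ 2 / 2⌋₊ - 2) 0) < E →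
            E < (hubbardTorus 2 L 1 U).minEnergyOn
                (szSector (2 * ⌊(1 - δ) * (L : ℝ) ^ 2 / 2⌋₊ - 2) 0) + γ L →
              star w ⬝ᵥ (pairField dWaveFormFactor L *ᵥ g) = 0) ∧
      (∀ ε : ℝ, 0 < ε → ∃ L₀ : ℕ, ∀ (L : ℕ), Even L → L₀ ≤ L →
        (let e : ℕ → ℝ := fun n => (hubbardTorus 2 L 1 U).minEnergyOn (szSector n 0)
         let N : ℕ := 2 * ⌊(1 - δ) * (L : ℝ) ^ 2 / 2⌋₊
         2 * e N - e (N + 2) - e (N - 2) ≤ ε * γ L)) := by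
  intro U δ hU hδ _hFO
  obtain ⟨γ, hγ, hLLO⟩ := hR U δ hU hδ
  refine ⟨γ, ?_, hLLO, chargingFloor_of_tendsto_atTop U δ hδ γ hγ⟩
  -- `γ_L → +∞` gives `γ_L L² → +∞`
  refine tendsto_atTop_atTop.2 fun b => ?_
  obtain ⟨L₁, hL₁⟩ := tendsto_atTop_atTop.1 hγ (max b 0)
  refine ⟨max L₁ 1, fun L hL => ?_⟩
  obtain ⟨hL₁', h1⟩ := max_le_iff.1 hL
  have hγL : max b 0 ≤ γ L := hL₁ L hL₁'
  have hγ0 : 0 ≤ γ L := le_trans (le_max_right _ _) hγL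
  have hb : b ≤ γ L := le_trans (le_max_left _ _) hγL
  have hL1 : (1 : ℝ) ≤ (L : ℝ) ^ 2 := by
    have h : (1 : ℝ) ≤ L := by exact_mod_cast h1
    nlinarith
  calc b ≤ γ L := hb
    _ = γ L * 1 := (mul_one _).symm
    _ ≤ γ L * (L : ℝ) ^ 2 := mul_le_mul_of_nonneg_left hL1 hγ0

end Summit.HubbardSuperconductivity.HubbardSuperconductivity.Theorems.JosephsonMirror
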